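import Summits.Ventures.GridStability.Lyapunov.NE39LossySplitLinesU3o200LPCert
import Summits.Ventures.GridStability.Bench.NE39LossySplitLinesU3o200LPRoaData
import Summits.Ventures.GridStability.Bench.NE39LossySplitLinesLPRoa
import Summits.Ventures.GridStability.Models.ClassicalSwingGlobal
import Literature.Computation.Certificates.RankOneSolveCertificate
import HarnessLib

/-!
# «NE39-LOSSY-SPLITU» SECOND WINDOW — the positivity certificate's REGION on the lossy 39-bus 10-machine Kron model at
# `2·arctan(3/200)` (≈ 1.719°): rank-one level by ONE linear solve, ROA sentence, synchronisation, well-posedness, certified inner ball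

Cell `gridfusion` (LADDER-GRIDFUSION G2.c lossy Lur'e tier, 39-bus rung); seat gridfusion-lit-6 (g11; pipeline, generator
`probes/ne39/gen_ne39_lean.py` TAG `U3o200` and the certificate are g10's).  The certificate chain
`Lyapunov/NE39LossySplitLinesU3o200LPCert*.lean` (p597195) typed `lpCert : LPSlabCertificate NE39.splitLurieLinesSystem` (Schur form)
and its sector hypothesis `hsecL` at the WIDER window `2·arctan(3/200)` — the window where the positivity class is certified non-empty
while the class of record is certified EMPTY (★ #203, `NE39LossySplitLinesRecDual.positivityLever_split_NE39`).  THIS FILE turns that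
certificate into a REGION, by the recipe of the first-window file `Bench/NE39LossySplitLinesLPRoa.lean` (★ #168, window
`2·arctan(1/100)`, p590285) whose machine-coordinate lemmas `mem_slab_iff` / `CQ_sq_le_two` are REUSED by name (names of this
file carry the chain suffix `₂`):

* `rankOneL₂` — rank-one facts `s_k·(P + Cᵀdiag(λa)C) − C_kᵀC_k ⪰ 0` for all 200 channels by lit-6's LINEAR-SOLVE CERTIFICATE
  (`Literature/Computation/Certificates/RankOneSolveCertificate.lean`, Horn–Johnson Thm 7.7.7 one-sided / Cauchy–Schwarz):
  `lowlit ⪰ 0` WITHOUT a new `LDLᵀ` (`lowlit = lowShift₂ + ε·1`, `lower_ldl₂` of the certificate file), the exact solve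
  `lowlit·W = [0; 1]` on the nine angle columns decided ONCE (`low_mul_W₂`), `C_k = [0; 1]·C_k^θ` (`sel_mulVec₂`),
  `s_k ≥ C_k·(W C_k^θ)` (`sL_solve₂`);
* the level `c_rk = 1948267263/62500000000000` (≈ 3.117e-05; first window: ≈ 1.500e-05), `c_rk·s_k ≤ γ_lo²`,
  `γ_lo = 1200/40009 = sin γ < γ` (`gloLQ_lt_gamma₂`) ⇒ `hlevL₂`;
* **`lossy_splitLinesLP_slab_roa₂`** — for MODEL M = `NE39.preLossless.toModelRel (1/10) 0`: every solution on `ℝ` whose initial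
  Lur'e state lies in the open slab `γ = 2·arctan(3/200)` (every `|(δ_p − δ_q) − (θ*_p − θ*_q)| < γ`, `mem_slab_iff`) with
  `V_LP ≤ lev ≤ c_rk` keeps both for all `t ≥ 0` and its Lur'e state tends to `0` (lit-6
  `LPSlabCertificate.well_subset_regionOfAttraction_of_rankOne` + the hypothesis-free bridge `NE39.hasDerivWithinAt_lurieState_lines`);
  `_sync₂` (machine coordinates), `_wellPosed₂` (∃! solution, model-1's `ClassicalSwing.exists_isSolutionOn_univ` / `isSolutionOn_univ_unique`);
* the CERTIFIED INNER BALL: `t·1 − (P + Cᵀdiag(λb)C) ⪰ 0`, `t = 279/1024` (`upper_ldl₂` on the table `uplit`, re-decided entrywise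
  `uplit_eq₂`), `ϱ = 114410074683/1000000000000000` (`ball_tests₂`), `|C_k|² ≤ 2` ⇒ `{x : xᵀx ≤ ϱ} ⊆ lpCert.well γ c_rk` (`ball_subset_wellL₂`),
  `lossy_splitLinesLP_ball_roa₂`: certified Lur'e-state radius `√ϱ ≈ 0.01070` (ten speeds + nine MACHINE angles relative to machine 0)
  — versus `√ϱ ≈ 0.00760` of the first-window certificate (both kernel facts about their own certificates; the balls are concentric
  in the same coordinates, so the first is contained in the second: `57727030459 ≤ 114410074683`).

THREE COLUMNS.  CERTIFIED for MODEL M, CLASS = the well `{slab 2·arctan(3/200), V_LP ≤ lev}` ∪ the ball — an INNER ROA estimate of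
the model's synchronous equilibrium, a priori over all solutions; the window `1.719°` is a certificate-class datum (kernel brackets:
positivity-class optimum ∈ [1.719°, 1.862°), class-of-record optimum ∈ [1.146°, 1.719°) — `NE39LossySplitLinesSlabCert.splitBrackets_adjacent_NE39`),
not a stability margin of any grid.  MODELLED: model-4's NE39 lossy Kron record (`NE39.preLossless`: 39-bus data reduced to the 10
internal nodes WITH transfer conductances; ASSUMED uniform damping `λ = 1/10`, `a′ = 0`; `θ* = preLossless.angleOf`).  VALIDATED:
producer lineage only (kit j293727 CLARABEL max-margin SDP `ν* ≈ 3.70e-06`, dyadic rounding `2^-24`; certificate files).  Nothing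
here says the 39-bus system or a grid is stable.
[cite: Pai1981, §2.16 Theorem [18] eqs. (2.63)–(2.64), §3.6.3 eqs. (3.43)–(3.45); Khalil2002, §7.1.2 Theorem 7.3, §4.8 Theorem 4.10; VuTuritsyn2017, §4.3 Theorem 1; HornJohnson2013, Thm 7.7.7]
-/

noncomputable section

open Real Set Filter Topology Matrix
open Literature.Computation.Certificates
open Literature.MathematicalPhysics.PowerSystems
open Literature.MathematicalPhysics.PowerSystems.LyapunovFunctionFamily
open Summit.Ventures.GridStability.Models
open Summit.Ventures.GridStability.Lyapunov.NE39LossySplitLines (e1 AQ CQ BLQ A_eq C_eq)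
open Summit.Ventures.GridStability.Lyapunov.NE39LossySplitLinesU3o200LPCert (PL₂ lamL₂ aL₂ bL₂ lowlit uplit epsLQ lowShift₂ lower_ldl₂ lowlit_eq₂ lpCert lpCert_a_b hsecL cos_sin_γL)
open Summit.Ventures.GridStability.Bench.NE39LossySplitLinesLPRoa (mem_slab_iff CQ_sq_le_two)

namespace Summit.Ventures.GridStability.Bench.NE39LossySplitLinesU3o200LPRoa

/-! ### Rank-one constants, level, lower matrix -/

/-- Half-tangent of the window: `u = 3/200`. -/
def uLQ₂ : ℚ := 3 / 200
/-- Inner rational width `γ_lo = 1200/40009` (`= sin γ ≤ γ`). -/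
def gloLQ₂ : ℚ := 1200/40009
/-- `s` on the typed channel index. -/
def sL₂ (k : ((Fin 10 × Fin 10) ⊕ (Fin 10 × Fin 10))) : ℚ := Sum.elim (fun pq : Fin 10 × Fin 10 => sTab₂ 0 pq.1 pq.2) (fun pq => sTab₂ 1 pq.1 pq.2) k
/-- The rank-one level `c_rk = 1948267263/62500000000000`. -/
def cRkLQ₂ : ℚ := 1948267263/62500000000000

/-- The lower matrix `P + Cᵀ·diag(λa)·C` over `ℚ` on the typed index (formula). -/
def lowerPQ₂ : Matrix (Fin 10 ⊕ Fin 9) (Fin 10 ⊕ Fin 9) ℚ := PL₂ + CQᵀ * Matrix.diagonal (fun k => lamL₂ k * aL₂ k) * CQ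

/-- `0 ≤ γ_lo`, `γ_lo²(1 + u²) ≤ 4u²` (i.e. `γ_lo ≤ sin γ`), `0 < u` (kernel arithmetic). -/
theorem gloL_test₂ : 0 ≤ gloLQ₂ ∧ gloLQ₂ ^ 2 * (1 + uLQ₂ ^ 2) ≤ 4 * uLQ₂ ^ 2 ∧ 0 < uLQ₂ := by
  refine ⟨by norm_num [gloLQ₂], by norm_num [gloLQ₂, uLQ₂], by norm_num [uLQ₂]⟩
/-- `0 < c_rk`. -/
theorem cRkLQ_pos₂ : 0 < cRkLQ₂ := by norm_num [cRkLQ₂]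

/-- The level tests `0 < s_k` and `c_rk·s_k ≤ γ_lo²` on every channel (kernel). -/
theorem sL_tests₂ : ∀ k : ((Fin 10 × Fin 10) ⊕ (Fin 10 × Fin 10)), 0 < sL₂ k ∧ cRkLQ₂ * sL₂ k ≤ gloLQ₂ ^ 2 := by
  decide +kernel

/-- `(Cᵀ·diag f·C) i j = Σ_k C_ki f_k C_kj` (plumbing). -/
private theorem tDt_apply₂ (f : ((Fin 10 × Fin 10) ⊕ (Fin 10 × Fin 10)) → ℚ) (i j : Fin 10 ⊕ Fin 9) :
    (CQᵀ * Matrix.diagonal f * CQ) i j = ∑ k, CQ k i * (f k * CQ k j) := by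
  rw [Matrix.mul_apply]; simp only [Matrix.mul_diagonal, Matrix.transpose_apply, mul_assoc]

/-- **The lower matrix formula IS the table** (typed; via file 1's entrywise re-decision `lowlit_eq₂`). -/
theorem lowerPQ_eq_F₂ : lowerPQ₂ = lowlit.submatrix e1 e1 := by
  ext i j
  have h := lowlit_eq₂ i j
  simp only [Lyapunov.NE39LossySplitLinesU3o200LPCert.lowF₂] at h
  rw [Matrix.submatrix_apply, h, lowerPQ₂, Matrix.add_apply, tDt_apply₂]
  simp only [Fintype.sum_sum_type, Fintype.sum_prod_type, mul_assoc]

/-! ### The linear-solve rank-one certificate (kernel) -/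

/-- The solve on the typed state index. -/
def WT₂ : Matrix (Fin 10 ⊕ Fin 9) (Fin 9) ℚ := fun i a => W19₂ (e1 i) a
/-- The right-hand sides `[0; 1]`: the nine angle coordinates. -/
def selT₂ : Matrix (Fin 10 ⊕ Fin 9) (Fin 9) ℚ := fun i a => Sum.elim (fun _ => 0) (fun a' : Fin 9 => if a' = a then 1 else 0) i
/-- The angle part of channel `k`'s row of `C`. -/
def uθ₂ (k : ((Fin 10 × Fin 10) ⊕ (Fin 10 × Fin 10))) : Fin 9 → ℚ := fun a => CQ k (Sum.inr a)

set_option maxHeartbeats 4000000 in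
/-- **The solve is EXACT**: `lowlit·W = [0; 1]` (kernel, 19 × 9 rational identities). -/
theorem low_mul_W₂ : lowlit.submatrix e1 e1 * WT₂ = selT₂ := by
  decide +kernel

/-- `C_k = [0; 1]·C_k^θ` for every channel (kernel). -/
theorem sel_mulVec₂ : ∀ k : ((Fin 10 × Fin 10) ⊕ (Fin 10 × Fin 10)), selT₂ *ᵥ uθ₂ k = CQ k := by
  decide +kernel

set_option maxHeartbeats 4000000 in
/-- **`s_k ≥ C_k·(W·C_k^θ)`** (`= C_k L⁻¹ C_kᵀ`) for every channel (kernel). -/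
theorem sL_solve₂ : ∀ k : ((Fin 10 × Fin 10) ⊕ (Fin 10 × Fin 10)), CQ k ⬝ᵥ WT₂ *ᵥ uθ₂ k ≤ sL₂ k := by
  decide +kernel

/-- `γ_lo < 2·arctan(3/200)`: `γ_lo = sin(2·arctan u) = 2u/(1+u²) < 2·arctan u`. -/
theorem gloLQ_lt_gamma₂ : ((gloLQ₂ : ℚ) : ℝ) < 2 * Real.arctan (3 / 200 : ℝ) := by
  have hsin : Real.sin (2 * Real.arctan (3 / 200 : ℝ)) = ((1200/40009 : ℚ) : ℝ) := cos_sin_γL.2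
  have hle : ((gloLQ₂ : ℚ) : ℝ) ≤ ((1200/40009 : ℚ) : ℝ) := by norm_num [gloLQ₂]
  have hpos : 0 < 2 * Real.arctan (3 / 200 : ℝ) := by
    have := Real.arctan_pos.2 (show (0 : ℝ) < 3 / 200 by norm_num)
    linarith
  have hlt : Real.sin (2 * Real.arctan (3 / 200 : ℝ)) < 2 * Real.arctan (3 / 200 : ℝ) := Real.sin_lt hpos
  linarith

/-! ### Cast plumbing -/

/-- `(M·N) ↦ ℝ` (plumbing). -/
private theorem map_mul' {m n o : Type*} [Fintype n] (M : Matrix m n ℚ) (N : Matrix n o ℚ) :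
    (M * N).map (Rat.cast : ℚ → ℝ) = M.map (Rat.cast : ℚ → ℝ) * N.map (Rat.cast : ℚ → ℝ) :=
  Matrix.map_mul (f := Rat.castHom ℝ)
/-- `(M + N) ↦ ℝ` (plumbing). -/
private theorem map_add' {m n : Type*} (M N : Matrix m n ℚ) :
    (M + N).map (Rat.cast : ℚ → ℝ) = M.map (Rat.cast : ℚ → ℝ) + N.map (Rat.cast : ℚ → ℝ) := by
  ext; simp
/-- `Mᵀ ↦ ℝ` (plumbing). -/
private theorem map_transpose' {m n : Type*} (M : Matrix m n ℚ) :
    Mᵀ.map (Rat.cast : ℚ → ℝ) = (M.map (Rat.cast : ℚ → ℝ))ᵀ := by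
  ext; simp
/-- `diagonal d ↦ ℝ` (plumbing). -/
private theorem map_diagonal' {n : Type*} [DecidableEq n] (d : n → ℚ) :
    (Matrix.diagonal d).map (Rat.cast : ℚ → ℝ) = Matrix.diagonal (fun i => ((d i : ℚ) : ℝ)) :=
  Matrix.diagonal_map (Rat.cast_zero)

/-- **The certificate's lower matrix is the cast of `lowerPQ₂`.** -/
theorem lowerMatrix_eq₂ : lpCert.lowerMatrix = lowerPQ₂.map (Rat.cast : ℚ → ℝ) := by
  have hd : Matrix.diagonal (fun k => lpCert.lam k * lpCert.a k)
      = (Matrix.diagonal (fun k => lamL₂ k * aL₂ k)).map (Rat.cast : ℚ → ℝ) := by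
    rw [map_diagonal']
    congr 1; funext k
    show ((lamL₂ k : ℚ) : ℝ) * ((aL₂ k : ℚ) : ℝ) = _
    push_cast; rfl
  rw [LPSlabCertificate.lowerMatrix, C_eq, hd, lowerPQ₂]
  show PL₂.map (Rat.cast : ℚ → ℝ) + _ = _
  simp only [map_add', map_mul', map_transpose']

/-- `lowlit ⪰ 0` over `ℝ` on the typed index — NOT re-decided: `lowlit = lowShift₂ + ε·1` with `lowShift₂ ⪰ 0` the certificate
file's coercivity fact (`lower_ldl₂`, kernel `LDLᵀ` already in the tree) and `ε = 1/2097152 ≥ 0`. -/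
private theorem low_psd₂ : ((lowlit.submatrix e1 e1).map (Rat.cast : ℚ → ℝ)).PosSemidef := by
  have h1 : (lowShift₂.map (Rat.cast : ℚ → ℝ)).PosSemidef := lower_ldl₂.posSemidef (R := ℝ)
  have h2 : (((epsLQ : ℚ) : ℝ) • (1 : Matrix (Fin 19) (Fin 19) ℝ)).PosSemidef :=
    Matrix.PosSemidef.one.smul (by exact_mod_cast (by norm_num [epsLQ] : (0 : ℚ) ≤ epsLQ))
  have e : lowlit.map (Rat.cast : ℚ → ℝ) = lowShift₂.map (Rat.cast : ℚ → ℝ) + ((epsLQ : ℚ) : ℝ) • (1 : Matrix (Fin 19) (Fin 19) ℝ) := by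
    ext i j
    by_cases hij : i = j
    · subst hij; simp [lowShift₂]
    · simp [lowShift₂, hij]
  have h : (lowlit.map (Rat.cast : ℚ → ℝ)).PosSemidef := by rw [e]; exact h1.add h2
  exact h.submatrix e1

/-- **Rank-one facts** `s_k·lowerMatrix − C_kᵀC_k ⪰ 0` for every channel — by the linear-solve certificate.
[cite: HornJohnson2013, Thm 7.7.7; VuTuritsyn2017, §4.3 Theorem 1 (eq. V_min); Khalil2002, §7.1.2 Theorem 7.3] -/
theorem rankOneL₂ (k : ((Fin 10 × Fin 10) ⊕ (Fin 10 × Fin 10))) :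
    (((sL₂ k : ℚ) : ℝ) • lpCert.lowerMatrix
      - Matrix.vecMulVec (NE39.splitLurieLinesSystem.C k) (NE39.splitLurieLinesSystem.C k)).PosSemidef := by
  have hC : NE39.splitLurieLinesSystem.C k = fun i => ((CQ k i : ℚ) : ℝ) := by
    rw [C_eq]; rfl
  rw [hC, lowerMatrix_eq₂, lowerPQ_eq_F₂]
  exact posSemidef_map_smul_sub_vecMulVec_of_mul_eq low_psd₂ low_mul_W₂ (uθ₂ k) (sel_mulVec₂ k) (sL_solve₂ k)

/-- `0 < s_k` (real). -/
theorem sL_pos₂ (k : ((Fin 10 × Fin 10) ⊕ (Fin 10 × Fin 10))) : (0 : ℝ) < ((sL₂ k : ℚ) : ℝ) := by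
  exact_mod_cast (sL_tests₂ k).1

/-- **Level hypothesis**: every `lev ≤ c_rk` satisfies `lev < γ²/s_k` on every channel (`c_rk·s_k ≤ γ_lo² < γ²`). -/
theorem hlevL₂ {lev : ℝ} (hle : lev ≤ ((cRkLQ₂ : ℚ) : ℝ)) (k : ((Fin 10 × Fin 10) ⊕ (Fin 10 × Fin 10))) :
    lev < (2 * Real.arctan (3 / 200 : ℝ)) ^ 2 / ((sL₂ k : ℚ) : ℝ) := by
  have hs := sL_pos₂ k
  have ht : ((cRkLQ₂ : ℚ) : ℝ) * ((sL₂ k : ℚ) : ℝ) ≤ ((gloLQ₂ : ℚ) : ℝ) ^ 2 := by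
    exact_mod_cast (sL_tests₂ k).2
  have hg0 : (0 : ℝ) ≤ ((gloLQ₂ : ℚ) : ℝ) := by exact_mod_cast gloL_test₂.1
  have hg := gloLQ_lt_gamma₂
  have hsq : ((gloLQ₂ : ℚ) : ℝ) ^ 2 < (2 * Real.arctan (3 / 200 : ℝ)) ^ 2 := by
    exact pow_lt_pow_left₀ hg hg0 two_ne_zero
  rw [lt_div_iff₀ hs]
  nlinarith

/-! ### THE SENTENCE -/

/-- **«NE39-LOSSY-SPLITU» — the certified region of the lossy 39-bus 10-machine Kron model at the window `2·arctan(3/200)`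
(≈ 1.719°), Lur'e–Postnikov POSITIVITY certificate (Schur form) on the UNORDERED-LINES split presentation.**  For MODEL
M = `NE39.preLossless.toModelRel (1/10) 0` (New-England 39-bus data Kron-reduced to the ten machine internal nodes WITH transfer
conductances, uniform damping ratio `1/10`, equilibrium `θ* = preLossless.angleOf`): every solution `c` on `ℝ` whose initial Lur'e
state lies in the open slab `γ = 2·arctan(3/200)` (every `|(δ_p − δ_q) − (θ*_p − θ*_q)| < γ`, `mem_slab_iff`) and has `V_LP ≤ lev` for a
level `lev ≤ c_rk = 1948267263/62500000000000` (`V_LP = xᵀPx + 2Σ_k λ_k∫₀^{y_k}F_k` of `lpCert`) keeps BOTH for all `t ≥ 0`, and its Lur'e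
state tends to `0`.  CERTIFIED for MODEL M, CLASS = the well (inner ROA estimate, a priori over all solutions); MODELLED as model-4's
record; nothing here says the 39-bus system is stable.
[cite: Pai1981, §2.16 Theorem [18] eqs. (2.63)–(2.64), §3.6.3 eqs. (3.43)–(3.45); Khalil2002, §7.1.2 Theorem 7.3] -/
theorem lossy_splitLinesLP_slab_roa₂ {lev : ℝ} (hle : lev ≤ ((cRkLQ₂ : ℚ) : ℝ))
    {c : ℝ → ClassicalSwing.State 10} (hc : (NE39.preLossless.toModelRel (1 / 10) 0).IsSolutionOn c univ)
    (h0 : NE39.preLossless.lurieState NE39.preLossless.angleOf (c 0) ∈ NE39.splitLurieLinesSystem.slab (fun _ => 2 * Real.arctan (3 / 200 : ℝ)))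
    (h0c : lpCert.V (NE39.preLossless.lurieState NE39.preLossless.angleOf (c 0)) ≤ lev) :
    (∀ t, 0 ≤ t →
        NE39.preLossless.lurieState NE39.preLossless.angleOf (c t) ∈ NE39.splitLurieLinesSystem.slab (fun _ => 2 * Real.arctan (3 / 200 : ℝ)) ∧
          lpCert.V (NE39.preLossless.lurieState NE39.preLossless.angleOf (c t)) ≤ lev) ∧
      Tendsto (fun t => NE39.preLossless.lurieState NE39.preLossless.angleOf (c t)) atTop (𝓝 0) := by
  have key := lpCert.well_subset_regionOfAttraction_of_rankOne (γ := fun _ => 2 * Real.arctan (3 / 200 : ℝ)) hsecL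
    (fun k => sL_pos₂ k) rankOneL₂ (hlevL₂ hle) (y := NE39.preLossless.lurieState NE39.preLossless.angleOf (c 0)) ⟨h0, h0c⟩
  have h2 := key.2 (fun t => NE39.preLossless.lurieState NE39.preLossless.angleOf (c t)) rfl
    fun T t _ => NE39.hasDerivWithinAt_lurieState_lines hc t
  exact ⟨fun t ht => ⟨(h2.1 t ht).1, (h2.1 t ht).2⟩, h2.2⟩

/-- **The same, read in machine coordinates (synchronisation).** For all `t ≥ 0` every machine-angle-difference deviation stays
`< 2·arctan(3/200)`; every speed deviation `ω_i(t) → 0`; every relative angle `δ_{a+1}(t) − δ_0(t) → θ*_{a+1} − θ*_0`.  MODELLED as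
model-4's record; nothing here says the 39-bus system is stable. [cite: Pai1981, §3.6.3 eqs. (3.43)–(3.45); Khalil2002, §7.1.2 Theorem 7.3] -/
theorem lossy_splitLinesLP_slab_sync₂ {lev : ℝ} (hle : lev ≤ ((cRkLQ₂ : ℚ) : ℝ))
    {c : ℝ → ClassicalSwing.State 10} (hc : (NE39.preLossless.toModelRel (1 / 10) 0).IsSolutionOn c univ)
    (h0 : ∀ p q : Fin 10, |((c 0).1 p - (c 0).1 q) - (NE39.preLossless.angleOf p - NE39.preLossless.angleOf q)| < 2 * Real.arctan (3 / 200 : ℝ))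
    (h0c : lpCert.V (NE39.preLossless.lurieState NE39.preLossless.angleOf (c 0)) ≤ lev) :
    (∀ t, 0 ≤ t → ∀ p q : Fin 10,
        |((c t).1 p - (c t).1 q) - (NE39.preLossless.angleOf p - NE39.preLossless.angleOf q)| < 2 * Real.arctan (3 / 200 : ℝ)) ∧
      (∀ i : Fin 10, Tendsto (fun t => (c t).2 i) atTop (𝓝 0)) ∧
      ∀ a : Fin 9, Tendsto (fun t => (c t).1 a.succ - (c t).1 0) atTop (𝓝 (NE39.preLossless.angleOf a.succ - NE39.preLossless.angleOf 0)) := by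
  obtain ⟨hkeep, hlim⟩ := lossy_splitLinesLP_slab_roa₂ hle hc ((mem_slab_iff _ _).2 h0) h0c
  have hcoord := tendsto_pi_nhds.1 hlim
  refine ⟨fun t ht => (mem_slab_iff _ _).1 (hkeep t ht).1, fun i => ?_, fun a => ?_⟩
  · have h := hcoord (Sum.inl i)
    simp only [RecastData.lurieState_eq, Sum.elim_inl, Pi.zero_apply] at h
    exact h
  · have h := hcoord (Sum.inr a)
    simp only [RecastData.lurieState_eq, Sum.elim_inr, Pi.zero_apply] at h
    have h2 := h.add_const (NE39.preLossless.angleOf a.succ - NE39.preLossless.angleOf 0)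
    simp only [zero_add, sub_add_cancel] at h2
    exact h2

/-- **Well-posed form**: for every machine state `z` with all `|(δ_p − δ_q) − (θ*_p − θ*_q)| < 2·arctan(3/200)` and
`V_LP(z) ≤ lev ≤ c_rk`: a solution of M on `ℝ` from `z` EXISTS, every solution from `z` is that one, and along it the deviations
stay in the window with `V_LP ≤ lev`, every `ω_i(t) → 0` and every relative angle converges to its equilibrium value.  MODELLED as
model-4's record. [cite: Khalil2002, §7.1.2 Theorem 7.3; Pai1981, §3.6.3 eqs. (3.43)–(3.45)] -/
theorem lossy_splitLinesLP_slab_wellPosed₂ {lev : ℝ} (hle : lev ≤ ((cRkLQ₂ : ℚ) : ℝ)) (z : ClassicalSwing.State 10)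
    (hz : ∀ p q : Fin 10, |(z.1 p - z.1 q) - (NE39.preLossless.angleOf p - NE39.preLossless.angleOf q)| < 2 * Real.arctan (3 / 200 : ℝ))
    (hzc : lpCert.V (NE39.preLossless.lurieState NE39.preLossless.angleOf z) ≤ lev) :
    (∃ c : ℝ → ClassicalSwing.State 10, c 0 = z ∧ (NE39.preLossless.toModelRel (1 / 10) 0).IsSolutionOn c univ) ∧
      ∀ c : ℝ → ClassicalSwing.State 10, c 0 = z → (NE39.preLossless.toModelRel (1 / 10) 0).IsSolutionOn c univ →
        (∀ c' : ℝ → ClassicalSwing.State 10, c' 0 = z → (NE39.preLossless.toModelRel (1 / 10) 0).IsSolutionOn c' univ → c' = c) ∧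
        (∀ t, 0 ≤ t →
          (∀ p q : Fin 10, |((c t).1 p - (c t).1 q) - (NE39.preLossless.angleOf p - NE39.preLossless.angleOf q)| < 2 * Real.arctan (3 / 200 : ℝ)) ∧
            lpCert.V (NE39.preLossless.lurieState NE39.preLossless.angleOf (c t)) ≤ lev) ∧
        (∀ i : Fin 10, Tendsto (fun t => (c t).2 i) atTop (𝓝 0)) ∧
        ∀ a : Fin 9, Tendsto (fun t => (c t).1 a.succ - (c t).1 0) atTop (𝓝 (NE39.preLossless.angleOf a.succ - NE39.preLossless.angleOf 0)) := by
  refine ⟨(NE39.preLossless.toModelRel (1 / 10) 0).exists_isSolutionOn_univ z, fun c hc0 hc => ?_⟩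
  have hkeep := lossy_splitLinesLP_slab_roa₂ hle hc ((mem_slab_iff _ _).2 (hc0.symm ▸ hz)) (hc0.symm ▸ hzc)
  have hsync := lossy_splitLinesLP_slab_sync₂ hle hc (hc0.symm ▸ hz) (hc0.symm ▸ hzc)
  refine ⟨fun c' hc0' hc' => (NE39.preLossless.toModelRel (1 / 10) 0).isSolutionOn_univ_unique hc' hc (hc0'.trans hc0.symm), ?_,
    hsync.2.1, hsync.2.2⟩
  intro t ht
  exact ⟨hsync.1 t ht, (hkeep.1 t ht).2⟩

/-! ### The certified inner ball -/

/-- Upper constant `t = 279/1024`: `t·1 − (P + Cᵀdiag(λb)C) ⪰ 0`. -/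
def tUQ₂ : ℚ := 279 / 1024
/-- Squared ball radius `ϱ = 114410074683/1000000000000000` (`≈ 1.144e-04`; radius ≈ 0.01070). -/
def rho2LQ₂ : ℚ := 114410074683 / 1000000000000000

/-- The upper matrix `P + Cᵀ·diag(λb)·C` over `ℚ` on the typed index (formula). -/
def upperPQ₂ : Matrix (Fin 10 ⊕ Fin 9) (Fin 10 ⊕ Fin 9) ℚ := PL₂ + CQᵀ * Matrix.diagonal (fun k => lamL₂ k * bL₂ k) * CQ
/-- The tabulated upper matrix on the typed index. -/
def upF₂ (i j : Fin 10 ⊕ Fin 9) : ℚ := uplit (e1 i) (e1 j)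

set_option maxHeartbeats 4000000 in
/-- **`uplit` is `P + Cᵀdiag(λb)C`** entrywise (kernel). -/
theorem uplit_eq₂ : ∀ i j : Fin 10 ⊕ Fin 9, upF₂ i j =
    PL₂ i j + ((∑ p : Fin 10, ∑ q : Fin 10, CQ (Sum.inl (p, q)) i * (lamL₂ (Sum.inl (p, q)) * bL₂ (Sum.inl (p, q))) * CQ (Sum.inl (p, q)) j)
        + (∑ p : Fin 10, ∑ q : Fin 10, CQ (Sum.inr (p, q)) i * (lamL₂ (Sum.inr (p, q)) * bL₂ (Sum.inr (p, q))) * CQ (Sum.inr (p, q)) j)) := by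
  decide +kernel

/-- **The upper matrix formula IS the table** (typed). -/
theorem upperPQ_eq_F₂ : upperPQ₂ = uplit.submatrix e1 e1 := by
  ext i j
  have h := uplit_eq₂ i j
  simp only [upF₂] at h
  rw [Matrix.submatrix_apply, h, upperPQ₂, Matrix.add_apply, tDt_apply₂]
  simp only [Fintype.sum_sum_type, Fintype.sum_prod_type, mul_assoc]

set_option maxHeartbeats 4000000 in
/-- **`t·1 − (P + Cᵀdiag(λb)C) ⪰ 0`** (19 × 19, kernel `LDLᵀ` on the table). -/
theorem upper_ldl₂ : PSD.LDLCert (tUQ₂ • (1 : Matrix (Fin 19) (Fin 19) ℚ) - uplit) := by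
  decide +kernel

/-- Ball tests: `0 ≤ t`, `t·ϱ ≤ c_rk`, `2ϱ ≤ γ_lo²`, `0 < ϱ`. -/
theorem ball_tests₂ : 0 ≤ tUQ₂ ∧ tUQ₂ * rho2LQ₂ ≤ cRkLQ₂ ∧ 2 * rho2LQ₂ ≤ gloLQ₂ ^ 2 ∧ 0 < rho2LQ₂ := by
  refine ⟨by norm_num [tUQ₂], by norm_num [tUQ₂, rho2LQ₂, cRkLQ₂], by norm_num [rho2LQ₂, gloLQ₂], by norm_num [rho2LQ₂]⟩

/-- **The second window's certified ball CONTAINS the first window's** (`ϱ₁ = 57727030459/10¹⁵ ≤ ϱ₂ = 114410074683/10¹⁵`;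
both balls live in the same Lur'e coordinates of MODEL M; `Bench/NE39LossySplitLinesLPRoa.rho2LQ` is the first window's `ϱ`). -/
theorem firstBall_subset_ball₂ :
    {x : (Fin 10 ⊕ Fin 9) → ℝ | x ⬝ᵥ x ≤ ((NE39LossySplitLinesLPRoa.rho2LQ : ℚ) : ℝ)}
      ⊆ {x : (Fin 10 ⊕ Fin 9) → ℝ | x ⬝ᵥ x ≤ ((rho2LQ₂ : ℚ) : ℝ)} := by
  intro x hx
  have h : ((NE39LossySplitLinesLPRoa.rho2LQ : ℚ) : ℝ) ≤ ((rho2LQ₂ : ℚ) : ℝ) := by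
    exact_mod_cast (by norm_num [NE39LossySplitLinesLPRoa.rho2LQ, rho2LQ₂] : NE39LossySplitLinesLPRoa.rho2LQ ≤ rho2LQ₂)
  simp only [Set.mem_setOf_eq] at hx ⊢
  exact le_trans hx h

/-- **The certificate's upper matrix is the cast of `upperPQ₂`.** -/
theorem upperMatrix_eq₂ : lpCert.upperMatrix = upperPQ₂.map (Rat.cast : ℚ → ℝ) := by
  have hd : Matrix.diagonal (fun k => lpCert.lam k * lpCert.b k)
      = (Matrix.diagonal (fun k => lamL₂ k * bL₂ k)).map (Rat.cast : ℚ → ℝ) := by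
    rw [map_diagonal']
    congr 1; funext k
    show ((lamL₂ k : ℚ) : ℝ) * ((bL₂ k : ℚ) : ℝ) = _
    push_cast; rfl
  rw [LPSlabCertificate.upperMatrix, C_eq, hd, upperPQ₂]
  show PL₂.map (Rat.cast : ℚ → ℝ) + _ = _
  simp only [map_add', map_mul', map_transpose']

/-- `t·1 − upperMatrix ⪰ 0` over `ℝ`. -/
theorem upper_psd₂ : (((tUQ₂ : ℚ) : ℝ) • (1 : Matrix (Fin 10 ⊕ Fin 9) (Fin 10 ⊕ Fin 9) ℝ) - lpCert.upperMatrix).PosSemidef := by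
  have h := (upper_ldl₂.posSemidef (R := ℝ)).submatrix e1
  have e : ((tUQ₂ • (1 : Matrix (Fin 19) (Fin 19) ℚ) - uplit).map (Rat.cast : ℚ → ℝ)).submatrix e1 e1
      = ((tUQ₂ : ℚ) : ℝ) • (1 : Matrix (Fin 10 ⊕ Fin 9) (Fin 10 ⊕ Fin 9) ℝ) - lpCert.upperMatrix := by
    rw [upperMatrix_eq₂, upperPQ_eq_F₂]
    ext i j; by_cases hij : i = j
    · subst hij; simp
    · simp [hij, e1.injective.eq_iff]
  rwa [e] at h

/-- **The Euclidean ball `{x : xᵀx ≤ ϱ}` (Lur'e coordinates) lies inside the certified well at `2·arctan(3/200)`, level `c_rk`.**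
[cite: Khalil2002, §4.8 Theorem 4.10 (eq. (4.25)); Pai1981, §2.16 Theorem [18]] -/
theorem ball_subset_wellL₂ :
    {x : (Fin 10 ⊕ Fin 9) → ℝ | x ⬝ᵥ x ≤ ((rho2LQ₂ : ℚ) : ℝ)}
      ⊆ lpCert.well (fun _ => 2 * Real.arctan (3 / 200 : ℝ)) ((cRkLQ₂ : ℚ) : ℝ) := by
  have hγ : (0 : ℝ) < 2 * Real.arctan (3 / 200 : ℝ) := by
    have := Real.arctan_pos.mpr (show (0 : ℝ) < 3 / 200 by norm_num)
    linarith
  refine lpCert.ball_subset_well (γ := fun _ => 2 * Real.arctan (3 / 200 : ℝ)) (fun _ => hγ)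
    (by exact_mod_cast ball_tests₂.1) upper_psd₂ hsecL (by exact_mod_cast ball_tests₂.2.1) fun k => ?_
  have hC : NE39.splitLurieLinesSystem.C k = fun i => ((CQ k i : ℚ) : ℝ) := by
    rw [C_eq]; rfl
  have h1 : NE39.splitLurieLinesSystem.C k ⬝ᵥ NE39.splitLurieLinesSystem.C k = ((CQ k ⬝ᵥ CQ k : ℚ) : ℝ) := by
    rw [hC]; simp [dotProduct]
  have h2 : ((CQ k ⬝ᵥ CQ k : ℚ) : ℝ) ≤ 2 := by exact_mod_cast CQ_sq_le_two k
  have h3 : (2 : ℝ) * ((rho2LQ₂ : ℚ) : ℝ) ≤ ((gloLQ₂ : ℚ) : ℝ) ^ 2 := by exact_mod_cast ball_tests₂.2.2.1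
  have h4 : ((gloLQ₂ : ℚ) : ℝ) ^ 2 < (2 * Real.arctan (3 / 200 : ℝ)) ^ 2 :=
    pow_lt_pow_left₀ gloLQ_lt_gamma₂ (by exact_mod_cast gloL_test₂.1) two_ne_zero
  have h5 : (0 : ℝ) < ((rho2LQ₂ : ℚ) : ℝ) := by exact_mod_cast ball_tests₂.2.2.2
  rw [h1]
  nlinarith

/-- **Every solution of M from the ball `{xᵀx ≤ ϱ}` of Lur'e states stays in the certified well and synchronises.**
MODELLED as model-4's record; an inner estimate for THE MODEL, not a margin of any grid.
[cite: Khalil2002, §4.8 Theorem 4.10, §7.1.2 Theorem 7.3; Pai1981, §3.6.3 eqs. (3.43)–(3.45)] -/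
theorem lossy_splitLinesLP_ball_roa₂ {c : ℝ → ClassicalSwing.State 10} (hc : (NE39.preLossless.toModelRel (1 / 10) 0).IsSolutionOn c univ)
    (h0 : NE39.preLossless.lurieState NE39.preLossless.angleOf (c 0) ⬝ᵥ NE39.preLossless.lurieState NE39.preLossless.angleOf (c 0) ≤ ((rho2LQ₂ : ℚ) : ℝ)) :
    (∀ t, 0 ≤ t →
        NE39.preLossless.lurieState NE39.preLossless.angleOf (c t) ∈ NE39.splitLurieLinesSystem.slab (fun _ => 2 * Real.arctan (3 / 200 : ℝ)) ∧
          lpCert.V (NE39.preLossless.lurieState NE39.preLossless.angleOf (c t)) ≤ ((cRkLQ₂ : ℚ) : ℝ)) ∧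
      Tendsto (fun t => NE39.preLossless.lurieState NE39.preLossless.angleOf (c t)) atTop (𝓝 0) := by
  have hw := ball_subset_wellL₂ h0
  rw [LPSlabCertificate.mem_well_iff] at hw
  exact lossy_splitLinesLP_slab_roa₂ le_rfl hc hw.1 hw.2

end Summit.Ventures.GridStability.Bench.NE39LossySplitLinesU3o200LPRoa

end
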